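import Literature.Analysis.FluidPDE.AxisymmetricEuler
import Mathlib.Analysis.SpecialFunctions.Pow.Real
import HarnessLib

/-!
# Seregin 2020, Lemma 2.2 (after Nazarov–Uraltseva 2012): the real-number bookkeeping of
# N–U Lemma 3.2 (propagation of density) with cubic test profiles

Helper toward the stub `stub_seregin2020TypeII` of the crux `AxisymmetricKatoGlobal` (= the named
fact `Literature.Analysis.FluidPDE.Seregin2020_axisymmetricSingularPoint_typeII`, Seregin 2020,
Thm 2.1), reduced in the tree to the written-out hypothesis `hWH′` (= N–U 2012 Lemma 4.2 for the
class 𝒱). Pure real-number lemmata behind the atom `stub_L32_densityPropagation` of the cell's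
De Giorgi skeleton (sibling `…Lemma22DensityStub`): the annulus volume, the three error terms
of the slice estimate in N–U's Lemma 3.2 geometry, and the final bookkeeping ("choose `σ`, then
`θ₀`" — N–U: `1 - δ₀ ≤ (1 - δ₀/3)³ - (8/27)δ₀²`; with the cube profile the level ratio `γ` must
satisfy `1 - δ₀ < (1-γ)³(1-δ₀/3)`).

* `one_sub_three_mul_le_cube` — `1 - 3σ ≤ (1-σ)³`;
* `densityErr_real` — the error terms are `≤ E₁ √θ |B(ρ)|`;
* `densityPropagation_arith` — slice estimate + initial density + annulus + small errors give
  `|B(ρ) ∩ {Φ(t,·) < γκ}| ≤ (1 - δ₀/3)|B(ρ)|`.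

## References

* A. I. Nazarov, N. N. Uraltseva, St. Petersburg Math. J. 23 (2012) 93–115 = arXiv:1011.1888,
  §3, proof of Lemma 3.2. [NazarovUraltseva2012]
* G. Seregin, Anal. Math. Phys. 10 (2020), Paper 46 = arXiv:2006.04140, Lemma 2.2. [Seregin2020]
-/

-- the problem directory repeats the summit name (D-0017); core's `dupNamespace` linter fires
set_option linter.dupNamespace false

noncomputable section

open MeasureTheory Set Function Filter Topology Metric Module
open scoped NNReal ENNReal

namespace Summit.NavierStokesRegularity.NavierStokesRegularity.Theorems.AxisymmetricKatoGlobal.EulerScaling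


/-- `1 - 3σ ≤ (1 - σ)³` for `0 ≤ σ ≤ 3` (the annulus `B(ρ) ∖ B((1-σ)ρ)` has relative volume
`1 - (1-σ)³ ≤ 3σ`). [folklore] -/
theorem one_sub_three_mul_le_cube {σ : ℝ} (hσ0 : 0 ≤ σ) (hσ3 : σ ≤ 3) :
    1 - 3 * σ ≤ (1 - σ) ^ 3 := by
  nlinarith [mul_nonneg (mul_nonneg hσ0 hσ0) (sub_nonneg.2 hσ3)]

/-- The three error terms of the slice estimate in N–U's Lemma 3.2 geometry (cut-off from
`B((1-σ)ρ)` to `B((1-σ/2)ρ)`, time window `≤ θρ²`, `θ ≤ 1`) are at most `E₁ √θ |B(ρ)|` with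
`E₁ = 16C_g²/σ² + 4C_g c_U/(σ|B₁|) + 32 C_g C₁/(σ|B₁|)`. [folklore] -/
theorem densityErr_real {Cg C₁ V₁ N' σ θ ρ ta r₁ IU' : ℝ} (hCg : 0 ≤ Cg) (hC₁ : 0 ≤ C₁)
    (hV₁ : 0 < V₁) (hσ : 0 < σ) (hθ : 0 < θ) (hθs : θ ≤ θ ^ (1 / 2 : ℝ))
    (hρ : 0 < ρ) (hta : ta ≤ θ * ρ ^ 2) (hr₁0 : 0 ≤ r₁) (hr₁ : r₁ ≤ ρ)
    (hIU : IU' ≤ (16 * N') ^ (1 / 4 : ℝ) * (16 : ℝ) ^ (1 / 12 : ℝ) * V₁ ^ (2 / 3 : ℝ) *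
      θ ^ (1 / 2 : ℝ) * ρ ^ 4) :
    4 * (Cg / (σ / 2 * ρ)) ^ 2 * (ta * (V₁ * r₁ ^ 3)) + 2 * (Cg / (σ / 2 * ρ)) * IU' +
        4 * (Cg / (σ / 2 * ρ)) * (ta * (C₁ * (4 * r₁ ^ 2))) ≤
      ((16 * Cg ^ 2 / σ ^ 2 +
          4 * Cg * ((16 * N') ^ (1 / 4 : ℝ) * (16 : ℝ) ^ (1 / 12 : ℝ) * V₁ ^ (2 / 3 : ℝ)) / (σ * V₁) +
          32 * Cg * C₁ / (σ * V₁)) * θ ^ (1 / 2 : ℝ)) * (V₁ * ρ ^ 3) := by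
  have hσ0 : σ ≠ 0 := hσ.ne'
  have hρ0 : ρ ≠ 0 := hρ.ne'
  have hV0 : V₁ ≠ 0 := hV₁.ne'
  have hr₁3 : r₁ ^ 3 ≤ ρ ^ 3 := pow_le_pow_left₀ hr₁0 hr₁ 3
  have hr₁2 : r₁ ^ 2 ≤ ρ ^ 2 := pow_le_pow_left₀ hr₁0 hr₁ 2
  have hθh : 0 ≤ θ ^ (1 / 2 : ℝ) := by positivity
  -- term a
  have ta1 : 4 * (Cg / (σ / 2 * ρ)) ^ 2 * (ta * (V₁ * r₁ ^ 3)) ≤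
      16 * Cg ^ 2 / σ ^ 2 * θ ^ (1 / 2 : ℝ) * (V₁ * ρ ^ 3) := by
    have h1 : ta * (V₁ * r₁ ^ 3) ≤ θ * ρ ^ 2 * (V₁ * ρ ^ 3) :=
      mul_le_mul hta (mul_le_mul_of_nonneg_left hr₁3 hV₁.le) (by positivity) (by positivity)
    calc 4 * (Cg / (σ / 2 * ρ)) ^ 2 * (ta * (V₁ * r₁ ^ 3))
        ≤ 4 * (Cg / (σ / 2 * ρ)) ^ 2 * (θ * ρ ^ 2 * (V₁ * ρ ^ 3)) :=
          mul_le_mul_of_nonneg_left h1 (by positivity)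
      _ = 16 * Cg ^ 2 / σ ^ 2 * θ * (V₁ * ρ ^ 3) := by field_simp; ring
      _ ≤ 16 * Cg ^ 2 / σ ^ 2 * θ ^ (1 / 2 : ℝ) * (V₁ * ρ ^ 3) := by gcongr
  -- term b
  have tb1 : 2 * (Cg / (σ / 2 * ρ)) * IU' ≤
      4 * Cg * ((16 * N') ^ (1 / 4 : ℝ) * (16 : ℝ) ^ (1 / 12 : ℝ) * V₁ ^ (2 / 3 : ℝ)) / (σ * V₁) *
        θ ^ (1 / 2 : ℝ) * (V₁ * ρ ^ 3) := by
    calc 2 * (Cg / (σ / 2 * ρ)) * IU' ≤ 2 * (Cg / (σ / 2 * ρ)) *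
          ((16 * N') ^ (1 / 4 : ℝ) * (16 : ℝ) ^ (1 / 12 : ℝ) * V₁ ^ (2 / 3 : ℝ) * θ ^ (1 / 2 : ℝ) *
            ρ ^ 4) := mul_le_mul_of_nonneg_left hIU (by positivity)
      _ = _ := by field_simp; ring
  -- term c
  have tc1 : 4 * (Cg / (σ / 2 * ρ)) * (ta * (C₁ * (4 * r₁ ^ 2))) ≤
      32 * Cg * C₁ / (σ * V₁) * θ ^ (1 / 2 : ℝ) * (V₁ * ρ ^ 3) := by
    have h1 : ta * (C₁ * (4 * r₁ ^ 2)) ≤ θ * ρ ^ 2 * (C₁ * (4 * ρ ^ 2)) :=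
      mul_le_mul hta (mul_le_mul_of_nonneg_left (by linarith) hC₁) (by positivity) (by positivity)
    calc 4 * (Cg / (σ / 2 * ρ)) * (ta * (C₁ * (4 * r₁ ^ 2)))
        ≤ 4 * (Cg / (σ / 2 * ρ)) * (θ * ρ ^ 2 * (C₁ * (4 * ρ ^ 2))) :=
          mul_le_mul_of_nonneg_left h1 (by positivity)
      _ = 32 * Cg * C₁ / (σ * V₁) * θ * (V₁ * ρ ^ 3) := by field_simp; ring
      _ ≤ 32 * Cg * C₁ / (σ * V₁) * θ ^ (1 / 2 : ℝ) * (V₁ * ρ ^ 3) := by gcongr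
  calc _ ≤ 16 * Cg ^ 2 / σ ^ 2 * θ ^ (1 / 2 : ℝ) * (V₁ * ρ ^ 3) +
        4 * Cg * ((16 * N') ^ (1 / 4 : ℝ) * (16 : ℝ) ^ (1 / 12 : ℝ) * V₁ ^ (2 / 3 : ℝ)) / (σ * V₁) *
          θ ^ (1 / 2 : ℝ) * (V₁ * ρ ^ 3) +
        32 * Cg * C₁ / (σ * V₁) * θ ^ (1 / 2 : ℝ) * (V₁ * ρ ^ 3) := add_le_add (add_le_add ta1 tb1) tc1
    _ = _ := by ring

/-- The real-number bookkeeping of N–U Lemma 3.2: slice estimate + initial density + annulus +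
smallness of the errors give the density `1 - δ₀/3` of the sublevel set. [cite: NazarovUraltseva2012, proof of Lemma 3.2] -/
theorem densityPropagation_arith {δ₀ γ Δ σ e V κ m m₁ m₀ ann : ℝ}
    (hγ : 0 < γ) (hγ1 : γ < 1) (hκ : 0 < κ) (hV : 0 ≤ V) (hΔ0 : 0 ≤ Δ)
    (hΔ : Δ = (1 - γ) ^ 3 * (1 - δ₀ / 3) - (1 - δ₀))
    (hmain : ((1 - γ) * κ) ^ 3 * m₁ ≤ κ ^ 3 * m₀ + κ ^ 3 * (e * V)) (he : e ≤ Δ / 2)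
    (hm₀ : m₀ ≤ (1 - δ₀) * V) (hm : m ≤ m₁ + ann) (hann : ann ≤ 3 * σ * V) (hσ : 3 * σ ≤ Δ / 2) :
    m ≤ (1 - δ₀ / 3) * V := by
  have hg3 : 0 < (1 - γ) ^ 3 := by
    have : 0 < 1 - γ := by linarith
    positivity
  have hg3le : (1 - γ) ^ 3 ≤ 1 := by
    have h1 : 1 - γ ≤ 1 := by linarith
    have h0 : 0 ≤ 1 - γ := by linarith
    calc (1 - γ) ^ 3 ≤ 1 ^ 3 := pow_le_pow_left₀ h0 h1 3
      _ = 1 := one_pow 3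
  have hκ3 : 0 < κ ^ 3 := by positivity
  -- divide the main inequality by `κ³`
  have h1 : (1 - γ) ^ 3 * m₁ ≤ m₀ + e * V := by
    have : κ ^ 3 * ((1 - γ) ^ 3 * m₁) ≤ κ ^ 3 * (m₀ + e * V) := by
      calc κ ^ 3 * ((1 - γ) ^ 3 * m₁) = ((1 - γ) * κ) ^ 3 * m₁ := by ring
        _ ≤ κ ^ 3 * m₀ + κ ^ 3 * (e * V) := hmain
        _ = κ ^ 3 * (m₀ + e * V) := by ring
    exact le_of_mul_le_mul_left this hκ3
  have h2 : (1 - γ) ^ 3 * m₁ ≤ (1 - δ₀) * V + Δ / 2 * V := by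
    have : e * V ≤ Δ / 2 * V := mul_le_mul_of_nonneg_right he hV
    linarith
  have hannV : ann ≤ Δ / 2 * V := hann.trans (mul_le_mul_of_nonneg_right hσ hV)
  -- `(1-γ)³ m ≤ (1-γ)³ (m₁ + ann) ≤ (1-δ₀)V + Δ/2 V + (1-γ)³ Δ/2 V ≤ (1-γ)³ (1 - δ₀/3) V`
  have h3 : (1 - γ) ^ 3 * m ≤ (1 - γ) ^ 3 * ((1 - δ₀ / 3) * V) := by
    have hΔV : 0 ≤ Δ / 2 * V := by positivity
    calc (1 - γ) ^ 3 * m ≤ (1 - γ) ^ 3 * (m₁ + ann) := mul_le_mul_of_nonneg_left hm hg3.le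
      _ = (1 - γ) ^ 3 * m₁ + (1 - γ) ^ 3 * ann := by ring
      _ ≤ ((1 - δ₀) * V + Δ / 2 * V) + (1 - γ) ^ 3 * (Δ / 2 * V) :=
          add_le_add h2 (mul_le_mul_of_nonneg_left hannV hg3.le)
      _ ≤ ((1 - δ₀) * V + Δ / 2 * V) + 1 * (Δ / 2 * V) :=
          add_le_add le_rfl (mul_le_mul_of_nonneg_right hg3le hΔV)
      _ = (1 - γ) ^ 3 * ((1 - δ₀ / 3) * V) := by rw [hΔ]; ring
  exact le_of_mul_le_mul_left h3 hg3


end Summit.NavierStokesRegularity.NavierStokesRegularity.Theorems.AxisymmetricKatoGlobal.EulerScaling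

end
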